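import Literature.Probability.RandomPlanarGeometry.ExcursionRestrictionHarmonic
import Literature.Probability.Process.BrownianVecHarmonic
import Literature.Probability.RandomPlanarGeometry.RestrictionContinuityProofs
import HarnessLib

/-!
# The exit identity of [LSW] Prop. 4.1: `P[x₀ + W avoids A] = Im Φ_A(z₀)/Im z₀` for the four-dimensional Brownian motion

Proof file (one auxiliary notion with a real definition — the truncated domains —, no named
fact), after

* G. F. Lawler, O. Schramm, W. Werner, *Conformal restriction: the chordal case*, J. Amer.
  Math. Soc. **16** (2003) 917–955, arXiv:math/0209343 (**[LSW]**), §4, proof of Prop. 4.1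
  (p. 16), the display "`P[Z ⊂ ℍ ∖ A] = Im[Φ(z)]/Im(z)`" for the Brownian excursion `Z` started
  at `z ∈ ℍ ∖ A` — in [LSW] from the conformal invariance of planar Brownian motion ("`Φ ∘ W`
  is a time-changed Brownian motion");
* J.-F. Le Gall, *Brownian Motion, Martingales, and Stochastic Calculus*, GTM 274 (2016), Ch. 7
  §7.2, proof of Prop. 7.3 (harmonic functions along Brownian motion up to an exit time, and the
  passage to the limit).

In the tree's route (the excursion as `Z = exPt ∘ (x₀ + W)`, `W` a four-dimensional Brownian
motion, `Process.IsBrownianVec`; see `ExcursionRestrictionHarmonic`) the display becomes, for a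
starting point `x₀ ∈ D_A` (`exDom A`: spatial radius `≠ 0`, excursion point off `A`):

  `P[∀ t, exPt (x₀ + W_t) ∉ A] = U(x₀)`,   `U = excursionRatio Φ = Im Φ_A(exPt ·)/|w|`

(`Process.IsBrownianVec.measure_forall_exPt_notMem_eq_excursionRatio`), PROVED here from

* the stopped harmonic identity `E[U(x₀ + W_{t ∧ T_n})] = U(x₀)` of `Process/BrownianVecHarmonic`
  (`integral_stoppedProcess_eq_of_harmonic'`) on the truncated domains
  `exDomTrunc A n = {|w| > 1/(n+1), dist(exPt, A) > 1/(n+1)} ⋐ D_A` (`U` is `C²`, harmonic and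
  bounded by `1` there: `ExcursionRestrictionHarmonic`);
* the two sample-path properties of `x₀ + W` ASSUMED as hypotheses — almost surely the spatial
  radius never vanishes (polarity of the axis for `|W⃗|`) and tends to `∞` (transience) — which
  the tree proves separately for its Brownian model;
* the boundary values of `U` (`ExcursionRestrictionHarmonic`): `U → 0` at the points over `A`
  hit by the path (`tendsto_excursionRatio_of_mem`), `1 − C/|w| ≤ U ≤ 1` so that `U → 1` along
  a transient path avoiding `A` (`one_sub_div_le_excursionRatio`);
* two dominated convergences (`n → ∞` at fixed `t`, then `t → ∞`), the exit times `T_n ↑ T`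
  being controlled pathwise (`exists_forall_mem_exDomTrunc_of_isCompact`: a compact piece of
  path inside `D_A` lies in some truncated domain).

What then remains of Prop. 4.1 for the Brownian model is the passage from the starting point
`x₀ ∈ D_A` to the origin (Markov property at a small time `s` and `U(W_s) → Φ'_A(0)`,
`tendsto_excursionRatio_nhdsWithin_zero`).

## References

* [LSW] §4, proof of Prop. 4.1 (p. 16). [LawlerSchrammWerner2003Restriction]
* J.-F. Le Gall (2016), Ch. 7 §7.2, proof of Prop. 7.3. [Legall2016]
-/

noncomputable section

open MeasureTheory ProbabilityTheory Filter Set Metric Function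
open _root_.Topology
open UpperHalfPlane (upperHalfPlaneSet)
open Literature.Probability.Process
open Literature.Probability.Process.IsBrownianVec (hitTime hitTime_mono)
open scoped NNReal ENNReal

namespace Literature.Probability.RandomPlanarGeometry

/-! ### The truncated domains `D_A^{(n)} ⋐ D_A` -/

section Trunc

variable {A : Set ℂ}

/-- **The truncated domain** `D_A^{(n)} = {p : |w| > 1/(n+1), dist(exPt p, A) > 1/(n+1)}`.
[folklore] -/
def exDomTrunc (A : Set ℂ) (n : ℕ) : Set (Fin 4 → ℝ) :=
  {p | 1 / ((n : ℝ) + 1) < exRad p ∧ 1 / ((n : ℝ) + 1) < infDist (exPt p) A}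

/-- Continuity of `p ↦ dist(exPt p, A)`. [folklore] -/
theorem continuous_infDist_exPt (A : Set ℂ) : Continuous fun p : Fin 4 → ℝ ↦ infDist (exPt p) A :=
  (continuous_infDist_pt A).comp continuous_exPt

/-- The truncated domains are open. [folklore] -/
theorem isOpen_exDomTrunc (A : Set ℂ) (n : ℕ) : IsOpen (exDomTrunc A n) :=
  (isOpen_lt continuous_const continuous_exRad).inter
    (isOpen_lt continuous_const (continuous_infDist_exPt A))

/-- The truncated domains increase. [folklore] -/
theorem exDomTrunc_mono (A : Set ℂ) {n m : ℕ} (h : n ≤ m) : exDomTrunc A n ⊆ exDomTrunc A m := by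
  intro p hp
  have hle : 1 / ((m : ℝ) + 1) ≤ 1 / ((n : ℝ) + 1) :=
    one_div_le_one_div_of_le (by positivity) (by exact_mod_cast Nat.add_le_add_right h 1)
  exact ⟨hle.trans_lt hp.1, hle.trans_lt hp.2⟩

/-- The closure of a truncated domain lies in `D_A`. [folklore] -/
theorem closure_exDomTrunc_subset (A : Set ℂ) (n : ℕ) : closure (exDomTrunc A n) ⊆ exDom A := by
  have hcl : IsClosed {p : Fin 4 → ℝ | 1 / ((n : ℝ) + 1) ≤ exRad p ∧
      1 / ((n : ℝ) + 1) ≤ infDist (exPt p) A} :=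
    (isClosed_le continuous_const continuous_exRad).inter
      (isClosed_le continuous_const (continuous_infDist_exPt A))
  have hsub : exDomTrunc A n ⊆ {p : Fin 4 → ℝ | 1 / ((n : ℝ) + 1) ≤ exRad p ∧
      1 / ((n : ℝ) + 1) ≤ infDist (exPt p) A} := fun p hp ↦ ⟨hp.1.le, hp.2.le⟩
  intro p hp
  have hp' := closure_minimal hsub hcl hp
  have hpos : (0 : ℝ) < 1 / ((n : ℝ) + 1) := by positivity
  refine ⟨(hpos.trans_le hp'.1).ne', fun hA ↦ ?_⟩
  have := infDist_zero_of_mem hA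
  linarith [hp'.2]

/-- A truncated domain lies in `D_A`. [folklore] -/
theorem exDomTrunc_subset (A : Set ℂ) (n : ℕ) : exDomTrunc A n ⊆ exDom A :=
  subset_closure.trans (closure_exDomTrunc_subset A n)

/-- **A compact subset of `D_A` lies in some truncated domain** (`A` closed and nonempty: off
`A` the distance to `A` is positive). [folklore] -/
theorem exists_forall_mem_exDomTrunc_of_isCompact (hA : IsClosed A) (hne : A.Nonempty)
    {K : Set (Fin 4 → ℝ)} (hK : IsCompact K) (hKD : K ⊆ exDom A) : ∃ n, K ⊆ exDomTrunc A n := by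
  rcases K.eq_empty_or_nonempty with rfl | hKne
  · exact ⟨0, empty_subset _⟩
  set g : (Fin 4 → ℝ) → ℝ := fun p ↦ min (exRad p) (infDist (exPt p) A) with hg
  have hgc : Continuous g := continuous_exRad.min (continuous_infDist_exPt A)
  obtain ⟨p₀, hp₀, hmin⟩ := hK.exists_isMinOn hKne hgc.continuousOn
  have hgpos : 0 < g p₀ := by
    have h1 : 0 < exRad p₀ := exRad_pos (hKD hp₀).1
    have h2 : 0 < infDist (exPt p₀) A := (hA.notMem_iff_infDist_pos hne).1 (hKD hp₀).2
    exact lt_min h1 h2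
  obtain ⟨n, hn⟩ := exists_nat_one_div_lt hgpos
  refine ⟨n, fun p hp ↦ ?_⟩
  have hle : g p₀ ≤ g p := hmin hp
  exact ⟨(hn.trans_le hle).trans_le (min_le_left _ _), (hn.trans_le hle).trans_le (min_le_right _ _)⟩

/-- **A compact time-stretch of a continuous path inside `D_A` lies in some truncated domain.**
[folklore] -/
theorem exists_forall_mem_exDomTrunc_of_path (hA : IsClosed A) (hne : A.Nonempty)
    {γ : ℝ≥0 → (Fin 4 → ℝ)} (hγ : Continuous γ) {N : ℝ≥0} (hN : ∀ s ≤ N, γ s ∈ exDom A) :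
    ∃ n, ∀ s ≤ N, γ s ∈ exDomTrunc A n := by
  have hK : IsCompact (γ '' Icc 0 N) := (isCompact_Icc).image hγ
  have hKD : γ '' Icc 0 N ⊆ exDom A := by
    rintro _ ⟨s, hs, rfl⟩
    exact hN s hs.2
  obtain ⟨n, hn⟩ := exists_forall_mem_exDomTrunc_of_isCompact hA hne hK hKD
  exact ⟨n, fun s hs ↦ hn ⟨s, ⟨bot_le, hs⟩, rfl⟩⟩

end Trunc

/-! ### Pathwise control of the exit times of the truncated domains -/

section Pathwise

variable {Ω : Type*} {mΩ : MeasurableSpace Ω} {P : Measure Ω}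
  {W : ℝ≥0 → Ω → (Fin 4 → ℝ)} {A : Set ℂ} {x₀ : Fin 4 → ℝ} {ω : Ω}

/-- Before the exit time of `D_A` the path is in `D_A`. [folklore] -/
theorem mem_exDom_of_coe_lt_hitTime {s : ℝ≥0}
    (h : (s : WithTop ℝ≥0) < hitTime x₀ W (exDom A)ᶜ ω) : x₀ + W s ω ∈ exDom A := by
  have := notMem_of_coe_lt_hittingAfter_zero h
  rwa [mem_compl_iff, not_not] at this

/-- **If the path stays in `D_A` up to time `t`, the truncated domains are not left before `t`
for all large `n`.** [folklore] -/
theorem eventually_coe_lt_hitTime_exDomTrunc (hW : IsBrownianVec W P) (hAc : IsClosed A)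
    (hne : A.Nonempty) {t : ℝ≥0} (ht : ∀ s ≤ t, x₀ + W s ω ∈ exDom A) :
    ∀ᶠ n in atTop, (t : WithTop ℝ≥0) < hitTime x₀ W (exDomTrunc A n)ᶜ ω := by
  have hc : Continuous fun s ↦ x₀ + W s ω := continuous_const.add (hW.continuous_path ω)
  obtain ⟨n₀, hn₀⟩ := exists_forall_mem_exDomTrunc_of_path hAc hne hc ht
  refine eventually_atTop.2 ⟨n₀, fun n hn ↦ ?_⟩
  by_contra hle
  rw [not_lt] at hle
  obtain ⟨j, hj, hjF⟩ := (hW.hitTime_le_coe_iff (isOpen_exDomTrunc A n).isClosed_compl).1 hle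
  exact hjF (exDomTrunc_mono A hn (hn₀ j hj))

/-- The exit time of a truncated domain is at most the exit time of `D_A`. [folklore] -/
theorem hitTime_exDomTrunc_le (n : ℕ) (ω : Ω) :
    hitTime x₀ W (exDomTrunc A n)ᶜ ω ≤ hitTime x₀ W (exDom A)ᶜ ω :=
  hitTime_mono (compl_subset_compl.2 (exDomTrunc_subset A n)) ω

/-- **The stopped point lies in `D_A`**: for `x₀` in the truncated domain, the path stopped at
`t ∧ T_n` is in the closure of the truncated domain, hence in `D_A`. [folklore] -/
theorem stopped_mem_exDom (hW : IsBrownianVec W P) {n : ℕ} (hx : x₀ ∈ exDomTrunc A n) (t : ℝ≥0)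
    (ω : Ω) :
    x₀ + W (min (t : WithTop ℝ≥0) (hitTime x₀ W (exDomTrunc A n)ᶜ ω)).untopA ω ∈ exDom A := by
  have h := hW.mem_closure_compl_of_le (isOpen_exDomTrunc A n).isClosed_compl
    (fun h ↦ h hx) t ω le_rfl
  rw [compl_compl] at h
  exact closure_exDomTrunc_subset A n h

variable {Φ : ConformalEquiv (upperHalfPlaneSet \ A) upperHalfPlaneSet}

/-- **The stopped values are in `(0, 1]`.** [folklore] -/
theorem abs_stoppedProcess_excursionRatio_le_one (hW : IsBrownianVec W P) (hAb : Bornology.IsBounded A)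
    (hΦ : IsRestrictionMap A Φ) {n : ℕ} (hx : x₀ ∈ exDomTrunc A n) (t : ℝ≥0) (ω : Ω) :
    |stoppedProcess (fun r ω ↦ excursionRatio Φ (x₀ + W r ω)) (hitTime x₀ W (exDomTrunc A n)ᶜ) t ω|
      ≤ 1 := by
  have hmem := stopped_mem_exDom hW hx t ω
  change |excursionRatio Φ (x₀ + W (min (t : WithTop ℝ≥0)
    (hitTime x₀ W (exDomTrunc A n)ᶜ ω)).untopA ω)| ≤ 1
  rw [abs_le]
  exact ⟨by linarith [excursionRatio_pos (Φ := Φ) hmem], excursionRatio_le_one hAb hΦ hmem⟩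

/-- **Pathwise limit of the stopped values as `n → ∞`** (polar path: the spatial radius never
vanishes): if `t` is before the exit time `T` of `D_A` the stopped values are eventually
`U(x₀ + W_t)`; otherwise `T_n → T`, the stopped points tend inside `D_A` to the exit point,
which lies over `A`, and the stopped values tend to `0`. [folklore] -/
theorem tendsto_stoppedProcess_excursionRatio (hW : IsBrownianVec W P) (hA : IsStarHull A)
    (hne : A.Nonempty) (hΦ : IsRestrictionMap A Φ) (hx : x₀ ∈ exDom A)
    (hpol : ∀ s : ℝ≥0, exRad (x₀ + W s ω) ≠ 0) (t : ℝ≥0) :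
    Tendsto (fun n ↦ stoppedProcess (fun r ω ↦ excursionRatio Φ (x₀ + W r ω))
        (hitTime x₀ W (exDomTrunc A n)ᶜ) t ω) atTop
      (𝓝 (if (t : WithTop ℝ≥0) < hitTime x₀ W (exDom A)ᶜ ω then excursionRatio Φ (x₀ + W t ω)
        else 0)) := by
  have hAc : IsClosed A := hA.1.isClosed
  have hc : Continuous fun s ↦ x₀ + W s ω := continuous_const.add (hW.continuous_path ω)
  set T := hitTime x₀ W (exDom A)ᶜ ω with hT_def
  by_cases ht : (t : WithTop ℝ≥0) < T
  · -- before the exit time: eventually `t < T_n`, the stopped value is `U(X_t)`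
    rw [if_pos ht]
    have hin : ∀ s ≤ t, x₀ + W s ω ∈ exDom A := fun s hs ↦
      mem_exDom_of_coe_lt_hitTime ((WithTop.coe_le_coe.2 hs).trans_lt ht)
    refine tendsto_const_nhds.congr' ?_
    filter_upwards [eventually_coe_lt_hitTime_exDomTrunc hW hAc hne hin] with n hn
    rw [stoppedProcess_eq_of_le hn.le]
  · -- after the exit time `T = T₀ ≤ t`
    rw [if_neg ht]
    rw [not_lt] at ht
    have hTtop : T ≠ ⊤ := ne_top_of_le_ne_top WithTop.coe_ne_top ht
    obtain ⟨T₀, hT₀⟩ := WithTop.ne_top_iff_exists.1 hTtop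
    have hT₀' : T = T₀ := hT₀.symm
    have hT₀t : T₀ ≤ t := by rw [hT₀'] at ht; exact_mod_cast ht
    -- the exit point lies over `A`, with nonvanishing radius
    have hqF : x₀ + W T₀ ω ∈ (exDom A)ᶜ := hW.mem_of_hitTime_eq_coe (isOpen_exDom hAc).isClosed_compl hT₀'
    have hqA : exPt (x₀ + W T₀ ω) ∈ A := by
      by_contra h
      exact hqF ⟨hpol T₀, h⟩
    -- the truncated exit times `τ n ≤ T₀`, finite
    have hle : ∀ n, hitTime x₀ W (exDomTrunc A n)ᶜ ω ≤ T₀ := fun n ↦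
      (hitTime_exDomTrunc_le n ω).trans_eq hT₀'
    have hfin : ∀ n, hitTime x₀ W (exDomTrunc A n)ᶜ ω ≠ ⊤ := fun n ↦
      ne_top_of_le_ne_top WithTop.coe_ne_top (hle n)
    set τ : ℕ → ℝ≥0 := fun n ↦ (hitTime x₀ W (exDomTrunc A n)ᶜ ω).untopA with hτ_def
    have hτeq : ∀ n, hitTime x₀ W (exDomTrunc A n)ᶜ ω = (τ n : WithTop ℝ≥0) := fun n ↦ by
      rw [hτ_def]
      simp only
      rw [WithTop.untopA_eq_untop (hfin n), WithTop.coe_untop]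
    have hτle : ∀ n, τ n ≤ T₀ := fun n ↦ by
      have := hle n
      rw [hτeq n] at this
      exact_mod_cast this
    -- the stopped value is `U(X_{τ n})`
    have hval : ∀ n, stoppedProcess (fun r ω ↦ excursionRatio Φ (x₀ + W r ω))
        (hitTime x₀ W (exDomTrunc A n)ᶜ) t ω = excursionRatio Φ (x₀ + W (τ n) ω) := fun n ↦ by
      rw [stoppedProcess_eq_of_ge ((hle n).trans (WithTop.coe_le_coe.2 hT₀t))]
    simp_rw [hval]
    -- `τ n → T₀`
    have hτT : Tendsto τ atTop (𝓝 T₀) := by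
      rw [tendsto_order]
      refine ⟨fun a ha ↦ ?_, fun b hb ↦ Eventually.of_forall fun n ↦ (hτle n).trans_lt hb⟩
      have hin : ∀ s ≤ a, x₀ + W s ω ∈ exDom A := fun s hs ↦
        mem_exDom_of_coe_lt_hitTime (by
          rw [← hT_def, hT₀']
          exact_mod_cast hs.trans_lt ha)
      filter_upwards [eventually_coe_lt_hitTime_exDomTrunc hW hAc hne hin] with n hn
      rw [hτeq n] at hn
      exact_mod_cast hn
    -- the stopped points are in `D_A` for large `n` (once `x₀ ∈ D_A^{(n)}`)
    obtain ⟨n₀, hn₀⟩ := exists_forall_mem_exDomTrunc_of_isCompact hAc hne isCompact_singleton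
      (singleton_subset_iff.2 hx)
    have hmemD : ∀ᶠ n in atTop, x₀ + W (τ n) ω ∈ exDom A := by
      refine eventually_atTop.2 ⟨n₀, fun n hn ↦ ?_⟩
      have hxn : x₀ ∈ exDomTrunc A n := exDomTrunc_mono A hn (hn₀ rfl)
      have h := stopped_mem_exDom hW hxn t ω
      rwa [min_eq_right ((hle n).trans (WithTop.coe_le_coe.2 hT₀t)), hτeq n] at h
    -- conclude with the boundary behaviour of `U` over `A`
    have hlim : Tendsto (fun n ↦ x₀ + W (τ n) ω) atTop (𝓝[exDom A] (x₀ + W T₀ ω)) :=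
      tendsto_nhdsWithin_iff.2 ⟨(hc.tendsto T₀).comp hτT, hmemD⟩
    exact (tendsto_excursionRatio_of_mem hA hΦ (hpol T₀) hqA).comp hlim

/-- **Pathwise limit as `t → ∞`** (transient path): the limit values
`L_t = 𝟙{t < T} U(x₀ + W_t)` tend to `𝟙{T = ∞}` — along a path avoiding `A` forever,
`U(x₀ + W_t) → 1` since `1 − C/|w| ≤ U ≤ 1` and `|w| → ∞`. [folklore] -/
theorem tendsto_limitValue_excursionRatio (hA : IsStarHull A) (hΦ : IsRestrictionMap A Φ)
    (htr : Tendsto (fun s : ℝ≥0 ↦ exRad (x₀ + W s ω)) atTop atTop) :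
    Tendsto (fun k : ℕ ↦ if ((k : ℝ≥0) : WithTop ℝ≥0) < hitTime x₀ W (exDom A)ᶜ ω then
        excursionRatio Φ (x₀ + W (k : ℝ≥0) ω) else 0) atTop
      (𝓝 ({ω | hitTime x₀ W (exDom A)ᶜ ω = ⊤}.indicator 1 ω)) := by
  set T := hitTime x₀ W (exDom A)ᶜ ω with hT_def
  by_cases hT : T = ⊤
  · -- the path stays in `D_A` forever and `U → 1` along it
    rw [indicator_of_mem (show ω ∈ {ω | hitTime x₀ W (exDom A)ᶜ ω = ⊤} from hT), Pi.one_apply]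
    have hlt : ∀ k : ℕ, ((k : ℝ≥0) : WithTop ℝ≥0) < T := fun k ↦ by rw [hT]; exact WithTop.coe_lt_top _
    simp_rw [if_pos (hlt _)]
    have hmem : ∀ s : ℝ≥0, x₀ + W s ω ∈ exDom A := fun s ↦
      mem_exDom_of_coe_lt_hitTime (by rw [← hT_def, hT]; exact WithTop.coe_lt_top _)
    obtain ⟨C, hC⟩ := one_sub_div_le_excursionRatio hA hΦ
    have hrad : Tendsto (fun k : ℕ ↦ exRad (x₀ + W (k : ℝ≥0) ω)) atTop atTop :=
      htr.comp tendsto_natCast_atTop_atTop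
    have hlow : Tendsto (fun k : ℕ ↦ 1 - C / exRad (x₀ + W (k : ℝ≥0) ω)) atTop (𝓝 1) := by
      have h := hrad.const_div_atTop C
      simpa using (tendsto_const_nhds (x := (1 : ℝ))).sub h
    exact tendsto_of_tendsto_of_tendsto_of_le_of_le hlow tendsto_const_nhds
      (fun k ↦ hC _ (hmem _)) (fun k ↦ excursionRatio_le_one hA.1.1 hΦ (hmem _))
  · -- after the finite exit time the values are `0`
    rw [indicator_of_notMem (show ω ∉ {ω | hitTime x₀ W (exDom A)ᶜ ω = ⊤} from hT), ]
    obtain ⟨T₀, hT₀⟩ := WithTop.ne_top_iff_exists.1 hT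
    refine tendsto_const_nhds.congr' ?_
    obtain ⟨k₀, hk₀⟩ := exists_nat_ge (T₀ : ℝ)
    refine eventually_atTop.2 ⟨k₀, fun k hk ↦ ?_⟩
    have hle : T ≤ ((k : ℝ≥0) : WithTop ℝ≥0) := by
      rw [← hT₀]
      exact WithTop.coe_le_coe.2 (by
        rw [← NNReal.coe_le_coe]
        push_cast
        exact hk₀.trans (by exact_mod_cast hk))
    simp only [if_neg (not_lt.2 hle)]

end Pathwise

/-! ### The exit identity -/

section Exit

variable {Ω : Type*} {mΩ : MeasurableSpace Ω} {P : Measure Ω} [IsProbabilityMeasure P]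
  {W : ℝ≥0 → Ω → (Fin 4 → ℝ)} {A : Set ℂ}
  {Φ : ConformalEquiv (upperHalfPlaneSet \ A) upperHalfPlaneSet} {x₀ : Fin 4 → ℝ}

/-- **The stopped harmonic identity on the truncated domains**:
`E[U(x₀ + W_{t ∧ T_n})] = U(x₀)` for `x₀ ∈ D_A^{(n)}` (from
`Process.IsBrownianVec.integral_stoppedProcess_eq_of_harmonic'`: `U` is `C²`, harmonic and
bounded by `1` on `D_A ⊇ closure D_A^{(n)}`). [cite: Legall2016, Ch. 7 §7.2, proof of Prop. 7.3] -/
theorem integral_stoppedProcess_excursionRatio (hW : IsBrownianVec W P) (hAc : IsClosed A)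
    (hAb : Bornology.IsBounded A) (hΦ : IsRestrictionMap A Φ) {n : ℕ} (hx : x₀ ∈ exDomTrunc A n)
    (t : ℝ≥0) :
    Integrable (stoppedProcess (fun r ω ↦ excursionRatio Φ (x₀ + W r ω))
        (hitTime x₀ W (exDomTrunc A n)ᶜ) t) P ∧
      ∫ ω, stoppedProcess (fun r ω ↦ excursionRatio Φ (x₀ + W r ω))
        (hitTime x₀ W (exDomTrunc A n)ᶜ) t ω ∂P = excursionRatio Φ x₀ := by
  refine hW.integral_stoppedProcess_eq_of_harmonic' (isOpen_exDom hAc)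
    (contDiffOn_excursionRatio_two hAc) (fun y hy ↦ lap_excursionRatio_eq_zero hAc hy)
    (isOpen_exDomTrunc A n).isClosed_compl ?_ (C := 1) ?_ (fun h ↦ h hx) t
  · rw [compl_compl]; exact closure_exDomTrunc_subset A n
  · intro y hy
    rw [compl_compl] at hy
    have hyD := closure_exDomTrunc_subset A n hy
    rw [abs_le]
    exact ⟨by linarith [excursionRatio_pos (Φ := Φ) hyD], excursionRatio_le_one hAb hΦ hyD⟩

/-- **The exit identity of [LSW] Prop. 4.1 for a starting point in `D_A`**: for the
four-dimensional Brownian motion `W` and `x₀ ∈ D_A`, if almost surely the spatial radius of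
`x₀ + W` never vanishes and tends to `∞`, then
`P[∀ t, exPt (x₀ + W_t) ∉ A] = U(x₀) = Im Φ_A(exPt x₀)/|w(x₀)|` — the display
"`P[Z ⊂ ℍ ∖ A] = Im[Φ(z)]/Im(z)`" of the printed proof, here by the stopped harmonic identity on
the truncated domains and two dominated convergences.
[cite: LawlerSchrammWerner2003Restriction, proof of Prop. 4.1 (p. 16); Legall2016, Ch. 7 §7.2, proof of Prop. 7.3] -/
theorem _root_.Literature.Probability.Process.IsBrownianVec.measure_forall_exPt_notMem_eq_excursionRatio
    (hW : IsBrownianVec W P)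
    (hA : IsStarHull A) (hΦ : IsRestrictionMap A Φ) (hx : x₀ ∈ exDom A)
    (hpolar : ∀ᵐ ω ∂P, ∀ s : ℝ≥0, exRad (x₀ + W s ω) ≠ 0)
    (htrans : ∀ᵐ ω ∂P, Tendsto (fun s : ℝ≥0 ↦ exRad (x₀ + W s ω)) atTop atTop) :
    P {ω | ∀ t : ℝ≥0, exPt (x₀ + W t ω) ∉ A} = ENNReal.ofReal (excursionRatio Φ x₀) := by
  have hAc : IsClosed A := hA.1.isClosed
  have hAb : Bornology.IsBounded A := hA.1.1
  set T : Ω → WithTop ℝ≥0 := hitTime x₀ W (exDom A)ᶜ with hT_def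
  -- the event `{∀ t, exPt ∉ A}` is a.s. `{T = ∞}`
  have hTm : MeasurableSet {ω | T ω = ⊤} :=
    (hW.isStoppingTime_hitTime (isOpen_exDom hAc).isClosed_compl).measurableSet_eq_top
  have hev : {ω | ∀ t : ℝ≥0, exPt (x₀ + W t ω) ∉ A} =ᵐ[P] {ω | T ω = ⊤} := by
    filter_upwards [hpolar] with ω hω
    simp only [eq_iff_iff]
    show (∀ t : ℝ≥0, exPt (x₀ + W t ω) ∉ A) ↔ T ω = ⊤
    rw [hT_def, hitTime, hittingAfter_eq_top_iff]
    exact ⟨fun h j _ hj ↦ hj ⟨hω j, h j⟩, fun h j ↦ (Set.notMem_compl_iff.1 (h j bot_le)).2⟩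
  rw [measure_congr hev]
  rcases A.eq_empty_or_nonempty with hAe | hne
  · -- `A = ∅`: both sides are `1`
    subst hAe
    have hT' : ∀ ω, T ω = ⊤ ↔ ∀ s : ℝ≥0, exRad (x₀ + W s ω) ≠ 0 := fun ω ↦ by
      rw [hT_def, hitTime, hittingAfter_eq_top_iff]
      exact ⟨fun h s ↦ (Set.notMem_compl_iff.1 (h s bot_le)).1, fun h j _ hj ↦ hj ⟨h j, notMem_empty _⟩⟩
    have hfull : ∀ᵐ ω ∂P, ω ∈ {ω | T ω = ⊤} := hpolar.mono fun ω hω ↦ (hT' ω).2 hω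
    have hc0 : P {ω | T ω = ⊤}ᶜ = 0 := measure_eq_zero_iff_ae_notMem.2 (hfull.mono fun ω hω h ↦ h hω)
    rw [(prob_compl_eq_zero_iff hTm).1 hc0]
    have hU : excursionRatio Φ x₀ = 1 := by
      rw [excursionRatio, IsRestrictionMap.apply_eq_self_of_eq_empty rfl hΦ (exPt_mem_of_mem hx).1,
        exPt_im, div_self hx.1]
    rw [hU, ENNReal.ofReal_one]
  -- `A ≠ ∅`: the truncated domains, shifted so that `x₀ ∈ D^{(n)}` for all `n`
  obtain ⟨n₀, hn₀⟩ := exists_forall_mem_exDomTrunc_of_isCompact hAc hne isCompact_singleton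
    (singleton_subset_iff.2 hx)
  have hxn : ∀ n, x₀ ∈ exDomTrunc A (n + n₀) := fun n ↦ exDomTrunc_mono A (Nat.le_add_left _ _) (hn₀ rfl)
  set S : ℕ → ℝ≥0 → Ω → ℝ := fun n t ω ↦ stoppedProcess (fun r ω ↦ excursionRatio Φ (x₀ + W r ω))
    (hitTime x₀ W (exDomTrunc A (n + n₀))ᶜ) t ω with hS_def
  set L : ℝ≥0 → Ω → ℝ := fun t ω ↦
    if (t : WithTop ℝ≥0) < T ω then excursionRatio Φ (x₀ + W t ω) else 0 with hL_def
  have hint : ∀ n t, Integrable (S n t) P ∧ ∫ ω, S n t ω ∂P = excursionRatio Φ x₀ := fun n t ↦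
    integral_stoppedProcess_excursionRatio hW hAc hAb hΦ (hxn n) t
  -- first dominated convergence: `∫ L_t = U(x₀)`
  have hlim1 : ∀ t, ∀ᵐ ω ∂P, Tendsto (fun n ↦ S n t ω) atTop (𝓝 (L t ω)) := fun t ↦ by
    filter_upwards [hpolar] with ω hω
    exact (tendsto_stoppedProcess_excursionRatio hW hA hne hΦ hx hω t).comp (tendsto_add_atTop_nat n₀)
  have hL : ∀ t, ∫ ω, L t ω ∂P = excursionRatio Φ x₀ := fun t ↦ by
    have h := tendsto_integral_of_dominated_convergence (fun _ ↦ (1 : ℝ))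
      (fun n ↦ (hint n t).1.aestronglyMeasurable) (integrable_const _)
      (fun n ↦ Eventually.of_forall fun ω ↦ by
        rw [Real.norm_eq_abs]
        exact abs_stoppedProcess_excursionRatio_le_one hW hAb hΦ (hxn n) t ω) (hlim1 t)
    have h' : Tendsto (fun n : ℕ ↦ ∫ ω, S n t ω ∂P) atTop (𝓝 (excursionRatio Φ x₀)) := by
      simp_rw [(hint _ t).2]
      exact tendsto_const_nhds
    exact tendsto_nhds_unique h h'
  -- second dominated convergence along `t = k → ∞`
  have hLm : ∀ t, AEStronglyMeasurable (L t) P := fun t ↦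
    aestronglyMeasurable_of_tendsto_ae atTop (fun n ↦ (hint n t).1.aestronglyMeasurable) (hlim1 t)
  have hLb : ∀ t ω, ‖L t ω‖ ≤ 1 := fun t ω ↦ by
    rw [Real.norm_eq_abs, hL_def]
    simp only
    split_ifs with h
    · have hmem := mem_exDom_of_coe_lt_hitTime h
      rw [abs_le]
      exact ⟨by linarith [excursionRatio_pos (Φ := Φ) hmem], excursionRatio_le_one hAb hΦ hmem⟩
    · simp
  have hlim2 : ∀ᵐ ω ∂P, Tendsto (fun k : ℕ ↦ L (k : ℝ≥0) ω) atTop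
      (𝓝 ({ω | T ω = ⊤}.indicator 1 ω)) := by
    filter_upwards [htrans] with ω h2
    exact tendsto_limitValue_excursionRatio hA hΦ h2
  have h := tendsto_integral_of_dominated_convergence (fun _ ↦ (1 : ℝ)) (fun k ↦ hLm _)
    (integrable_const _) (fun k ↦ Eventually.of_forall fun ω ↦ hLb _ ω) hlim2
  have h' : Tendsto (fun k : ℕ ↦ ∫ ω, L (k : ℝ≥0) ω ∂P) atTop (𝓝 (excursionRatio Φ x₀)) := by
    simp_rw [hL]
    exact tendsto_const_nhds
  have heq := tendsto_nhds_unique h h'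
  rw [integral_indicator_one hTm] at heq
  rw [← heq, ofReal_measureReal]

end Exit

end Literature.Probability.RandomPlanarGeometry

end
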